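import Summits.NavierStokesRegularity.NavierStokesRegularity.Theses.PalasekTowerBreakdown
import Summits.NavierStokesRegularity.FluidComputer.PalasekTowerRegisterGlobalReballFloors
import Summits.NavierStokesRegularity.FluidComputer.PalasekTowerRegisterGlobalCeiling
import Summits.NavierStokesRegularity.FluidComputer.PalasekTowerWindowFirstHitting

/-!
# NavierStokesRegularity — route `PalasekTowerBreakdown`, item `HeredityFromTwo`: the FOUR-STUB cut at the
# generic levels (no overshoot + the three floors, uniformly in `k ≥ 2`), the `k`-uniform speed jump, and the
# per-conjunct refutation templates, by name

Supports `stmt-NavierStokesRegularity-19250` (`PalasekTowerBreakdown.HeredityFromTwo := HeredityFrom 2`, the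
hand-overs `k → k + 1` for every `k ≥ 2`; it does NOT close it). Cell `ns-blowup`, seat `ns-palasek-19250-p1`
(g2, lead of record of the crux; birth line `Cruxes/HeredityFromTwo/Lines/birth.lean` v2 f6df89a9b00ae750 with
stubs `stub_apriori_ceiling : AprioriCeiling` / `stub_readout_floors : ReadoutFloors`, re-cut by this seat into v3
= the upper stub and the THREE `k`-uniform floor stubs below, mirroring the sibling line `Cruxes/HeredityAtOne`
v3). LABEL: E–C typing + kernel glue over the landed register (`FluidComputer/PalasekTowerRegisterGlobalFloorsAt`,
p452333; `…ReballFloors`, p457849; `…Ceiling`, p425507). WHAT THIS IS NOT: not NS — no stage, tower or instance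
is constructed; the item, its halves and the floors are OPEN `∀`-statements that appear only inside
equivalences, implications and refutation templates; no registered stage at any level `≥ 1` is known
(vacuity stands: every template below needs ONE).

* §1 `palasekTowerBreakdown_heredityFromTwo_iff_apriori_speed_strain_core` — the item in FOUR conjuncts, no
  hypothesis: `HeredityFromTwo ↔ AprioriCeiling ∧ (∀ k ≥ 2, SpeedFloorAt k) ∧ (∀ k ≥ 2, StrainFloorAt k) ∧
  (∀ k ≥ 2, CoreFloorAt k)` («no overshoot of `(5/3)·Y_{k+1}` before `τ_{k+1}`» ∧ «speed `≥ Y_{k+1}` in the ball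
  at `τ_{k+1}`» ∧ «strain `≥ A_{k+1}` there» ∧ «an `N_{k+1}`-core there», each asked of EVERY finite-energy
  classical continuation inside the ceiling of EVERY registered level-`k` stage of every pinned (`Λ = 8`,
  `θ = 6/5`) rigid quiet wide design, at EVERY `k ≥ 2`); composition, projections, and the lower stub alone
  (`palasekTowerBreakdown_readoutFloors_iff_floors3`).
* §2 the speed conjunct is a `k`-UNIFORM JUMP (the route's «constants do not drift with `k`» made explicit on the
  one conjunct where it is pure register arithmetic): on a rigid wide schedule `c₂ Y_k < (6/5)·c₂ Y_k ≤ c₁ Y_{k+1}`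
  and `2·c₁ Y_k ≤ c₁ Y_{k+1}` at EVERY level, so `SpeedFloorAt k` says that inside the window `(τ_k, τ_{k+1}]` the
  speed somewhere in the ball climbs to at least `6/5` of the speed ANYWHERE at `τ_k` and to at least twice the
  level-`k` floor — never inherited from `τ_k` (`palasekTowerBreakdown_speedFloorAt_exists_jump`,
  `…_exists_exceeds_stage`, and by name `palasekTowerBreakdown_heredityFromTwo_speed_jump`).
* §3 per-conjunct refutation TEMPLATES by name at a level `k ≥ 2` (re-balled forms of p457849: ONE registered
  level-`k` stage, ONE admissible radius, ONE tame continuation that is slow / flat / coreless at `τ_{k+1}`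
  throughout that ball ⇒ `¬ HeredityFromTwo`; the speed form is p457722's
  `palasekTowerBreakdown_not_heredityFromTwo_of_continuation_speed_lt`, not restated), and the abstract
  per-conjunct doors `…_of_not_speedFloorAt / _of_not_strainFloorAt / _of_not_coreFloorAt / _of_not_aprioriCeilingAt`.
* §4 the vacuous branch per conjunct: emptiness of the level-`2` register (`¬ RungG 2`, an amplification cap —
  none asserted) proves all four conjuncts at every `k ≥ 2`.

References: S. Palasek, arXiv:2605.13827 §4 [cite: Palasek2026ElementaryModel, §4]; H. Sohr, *The
Navier–Stokes Equations*, Birkhäuser 2001, Ch. V Thm. 1.5.1 [cite: Sohr2001, Ch. V Thm. 1.5.1].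
-/

-- `Summit.<Summit>.<Problem>` is the tree's mandated summit-side namespace (CONVENTIONS §2); for this
-- single-conjunct summit the two coincide, so the duplicate is deliberate.
set_option linter.dupNamespace false

namespace Summit.NavierStokesRegularity.NavierStokesRegularity.Theorems

open Set MeasureTheory
open scoped ENNReal ContDiff
open Literature.Analysis.FluidPDE
open Summit.NavierStokesRegularity.NavierStokesRegularity.Theses
open Summit.NavierStokesRegularity.FluidComputer.PalasekTowerClayBridge

/-! ## §1 The item in four `k`-uniform conjuncts -/

/-- **Item `HeredityFromTwo` ⇔ its four physics conjuncts, uniformly in the level — no hypothesis**: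
`PalasekTowerBreakdown.HeredityFromTwo ↔ AprioriCeiling ∧ (∀ k ≥ 2, SpeedFloorAt k) ∧ (∀ k ≥ 2, StrainFloorAt k)
∧ (∀ k ≥ 2, CoreFloorAt k)` (route decl by name; bodies `heredityFrom_two_iff_aprioriCeiling_and_floors` and
`readoutFloors_iff_forall_floors`). [cite: Palasek2026ElementaryModel, §4] -/
theorem palasekTowerBreakdown_heredityFromTwo_iff_apriori_speed_strain_core :
    PalasekTowerBreakdown.HeredityFromTwo ↔
      AprioriCeiling ∧ (∀ k : ℕ, 2 ≤ k → SpeedFloorAt k) ∧ (∀ k : ℕ, 2 ≤ k → StrainFloorAt k) ∧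
        (∀ k : ℕ, 2 ≤ k → CoreFloorAt k) := by
  unfold PalasekTowerBreakdown.HeredityFromTwo
  rw [heredityFrom_two_iff_aprioriCeiling_and_floors, readoutFloors_iff_forall_floors]
  constructor
  · rintro ⟨hA, h⟩
    exact ⟨hA, fun k hk => (h k hk).1, fun k hk => (h k hk).2.1, fun k hk => (h k hk).2.2⟩
  · rintro ⟨hA, h₁, h₂, h₃⟩
    exact ⟨hA, fun k hk => ⟨h₁ k hk, h₂ k hk, h₃ k hk⟩⟩

/-- **The composition the v3 line registers**: no overshoot + the three floors at every level `k ≥ 2` ⇒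
`PalasekTowerBreakdown.HeredityFromTwo`. [cite: Palasek2026ElementaryModel, §4] -/
theorem palasekTowerBreakdown_heredityFromTwo_of_apriori_speed_strain_core (hA : AprioriCeiling)
    (h₁ : ∀ k : ℕ, 2 ≤ k → SpeedFloorAt k) (h₂ : ∀ k : ℕ, 2 ≤ k → StrainFloorAt k)
    (h₃ : ∀ k : ℕ, 2 ≤ k → CoreFloorAt k) : PalasekTowerBreakdown.HeredityFromTwo :=
  palasekTowerBreakdown_heredityFromTwo_iff_apriori_speed_strain_core.2 ⟨hA, h₁, h₂, h₃⟩

/-- The item yields the speed floor at every level `k ≥ 2` (no W14). [cite: Sohr2001, Ch. V Thm. 1.5.1] -/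
theorem palasekTowerBreakdown_heredityFromTwo_speedFloorAt (h : PalasekTowerBreakdown.HeredityFromTwo)
    {k : ℕ} (hk : 2 ≤ k) : SpeedFloorAt k :=
  (palasekTowerBreakdown_heredityFromTwo_iff_apriori_speed_strain_core.1 h).2.1 k hk

/-- The item yields the strain floor at every level `k ≥ 2` (no W14). [cite: Sohr2001, Ch. V Thm. 1.5.1] -/
theorem palasekTowerBreakdown_heredityFromTwo_strainFloorAt (h : PalasekTowerBreakdown.HeredityFromTwo)
    {k : ℕ} (hk : 2 ≤ k) : StrainFloorAt k :=
  (palasekTowerBreakdown_heredityFromTwo_iff_apriori_speed_strain_core.1 h).2.2.1 k hk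

/-- The item yields the core floor at every level `k ≥ 2` (no W14). [cite: Sohr2001, Ch. V Thm. 1.5.1] -/
theorem palasekTowerBreakdown_heredityFromTwo_coreFloorAt (h : PalasekTowerBreakdown.HeredityFromTwo)
    {k : ℕ} (hk : 2 ≤ k) : CoreFloorAt k :=
  (palasekTowerBreakdown_heredityFromTwo_iff_apriori_speed_strain_core.1 h).2.2.2 k hk

/-- **The registered lower stub in three `k`-uniform floor stubs, losslessly**:
`ReadoutFloors ↔ (∀ k ≥ 2, SpeedFloorAt k) ∧ (∀ k ≥ 2, StrainFloorAt k) ∧ (∀ k ≥ 2, CoreFloorAt k)`. [folklore] -/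
theorem palasekTowerBreakdown_readoutFloors_iff_floors3 :
    ReadoutFloors ↔
      (∀ k : ℕ, 2 ≤ k → SpeedFloorAt k) ∧ (∀ k : ℕ, 2 ≤ k → StrainFloorAt k) ∧
        (∀ k : ℕ, 2 ≤ k → CoreFloorAt k) := by
  rw [readoutFloors_iff_forall_floors]
  exact ⟨fun h => ⟨fun k hk => (h k hk).1, fun k hk => (h k hk).2.1, fun k hk => (h k hk).2.2⟩,
    fun h k hk => ⟨h.1 k hk, h.2.1 k hk, h.2.2 k hk⟩⟩

/-- The lower stub of record from the three floor stubs (the derivation the v3 line uses). [folklore] -/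
theorem palasekTowerBreakdown_readoutFloors_of_floors3 (h₁ : ∀ k : ℕ, 2 ≤ k → SpeedFloorAt k)
    (h₂ : ∀ k : ℕ, 2 ≤ k → StrainFloorAt k) (h₃ : ∀ k : ℕ, 2 ≤ k → CoreFloorAt k) : ReadoutFloors :=
  palasekTowerBreakdown_readoutFloors_iff_floors3.2 ⟨h₁, h₂, h₃⟩

/-! ## §2 The speed conjunct is a `k`-uniform jump -/

/-- **Register arithmetic of a hand-over, every level**: on a rigid schedule on the wide-base rates the
level-`(k+1)` floor is at least `6/5` of the level-`k` ceiling and at least twice the level-`k` floor: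
`(6/5)·(c₂ Y_k) ≤ c₁ Y_{k+1}`, `c₂ Y_k < c₁ Y_{k+1}`, `2·(c₁ Y_k) ≤ c₁ Y_{k+1}` (`c₁ = 1`, `c₂ = 5/3`,
`Y_{k+1} ≥ 256^{13/100}·Y_k ≥ 2 Y_k`). No numerics beyond `TowerRates.wide_sep`. [folklore] -/
theorem palasekTowerBreakdown_handover_arithmetic {S : Schedule TowerRates.wide} (hR : S.Rigid) (k : ℕ) :
    6 / 5 * (S.c₂ * TowerRates.wide.Y k) ≤ S.c₁ * TowerRates.wide.Y (k + 1) ∧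
      S.c₂ * TowerRates.wide.Y k < S.c₁ * TowerRates.wide.Y (k + 1) ∧
      2 * (S.c₁ * TowerRates.wide.Y k) ≤ S.c₁ * TowerRates.wide.Y (k + 1) := by
  refine ⟨hR.sep_wide k, hR.ceiling_lt_floor_wide k, ?_⟩
  rw [hR.c₁_eq, one_mul, one_mul]
  exact TowerRates.wide_sep k

/-- **`SpeedFloorAt k` is a JUMP produced inside the window `(τ_k, τ_{k+1}]`, at EVERY level `k`**: every tame
continuation `u` of a registered level-`k` stage shows at `τ_{k+1}` a point `x` of the ball with
`‖u(τ_{k+1}, x)‖ ≥ c₁ Y_{k+1} ≥ (6/5)·(c₂ Y_k)` and `> c₂ Y_k` — strictly above the level-`k` ceiling that binds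
the whole history on `[0, τ_k]`. [cite: Palasek2026ElementaryModel, §4] -/
theorem palasekTowerBreakdown_speedFloorAt_exists_jump {k : ℕ} (h : SpeedFloorAt k) :
    ReadoutAt k (fun S v => ∃ x, ‖x‖ ≤ S.radius ∧ S.c₁ * TowerRates.wide.Y (k + 1) ≤ ‖v x‖ ∧
      6 / 5 * (S.c₂ * TowerRates.wide.Y k) ≤ ‖v x‖ ∧ S.c₂ * TowerRates.wide.Y k < ‖v x‖) := by
  intro S hP hR hQ s u p hcl hagree hE hceil
  obtain ⟨x, hx, hfl⟩ := h S hP hR hQ s u p hcl hagree hE hceil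
  obtain ⟨hsep, hlt, -⟩ := palasekTowerBreakdown_handover_arithmetic hR k
  exact ⟨x, hx, hfl, hsep.trans hfl, lt_of_lt_of_le hlt hfl⟩

/-- **The jump read against the stage, every level**: under `SpeedFloorAt k`, for every tame continuation `u` of
a registered level-`k` stage `s` of a pinned rigid quiet wide design there is a point `x` of the ball with
`(6/5)·‖s.u(τ_k, y)‖ ≤ ‖u(τ_{k+1}, x)‖` and `‖s.u(τ_k, y)‖ < ‖u(τ_{k+1}, x)‖` for ALL `y ∈ ℝ³` (the stage's own
level-`k` ceiling `‖s.u(τ_k, ·)‖ ≤ c₂ Y_k`): the speed maximum over space grows by at least `20 %` across the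
window — the same factor at every level. [cite: Palasek2026ElementaryModel, §4] -/
theorem palasekTowerBreakdown_speedFloorAt_exists_exceeds_stage {k : ℕ} (h : SpeedFloorAt k) :
    ∀ S : Schedule TowerRates.wide, S.Pins 8 (6 / 5) → S.Rigid → S.Quiet →
      ∀ s : Stage 1 TowerRates.wide S (Margins.routeG TowerRates.wide) k,
      ∀ (u : ℝ → EuclideanSpace ℝ (Fin 3) → EuclideanSpace ℝ (Fin 3))
        (p : ℝ → EuclideanSpace ℝ (Fin 3) → ℝ),
        IsClassicalNSSolutionOn (Icc 0 (S.τ (k + 1))) 1 S.f u p →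
        (∀ t ∈ Icc 0 (S.τ k), u t = s.u t ∧ p t = s.p t) →
        (∃ C : ℝ≥0∞, C < ⊤ ∧ ∀ t ∈ Icc 0 (S.τ (k + 1)), ∫⁻ x, ‖u t x‖ₑ ^ 2 ≤ C) →
        (∀ t ∈ Icc 0 (S.τ (k + 1)), ∀ x, ‖u t x‖ ≤ S.c₂ * TowerRates.wide.Y (k + 1)) →
        ∃ x, ‖x‖ ≤ S.radius ∧
          ∀ y, 6 / 5 * ‖s.u (S.τ k) y‖ ≤ ‖u (S.τ (k + 1)) x‖ ∧ ‖s.u (S.τ k) y‖ < ‖u (S.τ (k + 1)) x‖ := by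
  intro S hP hR hQ s u p hcl hagree hE hceil
  obtain ⟨x, hx, -, hsep, hlt⟩ :=
    palasekTowerBreakdown_speedFloorAt_exists_jump h S hP hR hQ s u p hcl hagree hE hceil
  refine ⟨x, hx, fun y => ?_⟩
  have hc := s.ceiling k le_rfl (S.τ k) ⟨(S.τ_pos k).le, le_rfl⟩ y
  exact ⟨le_trans (by linarith) hsep, lt_of_le_of_lt hc hlt⟩

/-- **The speed jump BY NAME, uniformly in the level.** Under `PalasekTowerBreakdown.HeredityFromTwo`: for every
`k ≥ 2`, every pinned rigid quiet wide schedule, every registered level-`k` stage `s` and every finite-energy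
classical continuation `(u, p)` of `s` to `τ_{k+1}` inside `(5/3)·Y_{k+1}`, some point `x` of the ball has
`‖u(τ_{k+1}, x)‖ ≥ (6/5)·‖s.u(τ_k, y)‖` and `> ‖s.u(τ_k, y)‖` for ALL `y ∈ ℝ³`. The item therefore asserts, for
every design and every generic level with the SAME factor, a `≥ 20 %` growth of the spatial speed maximum inside
each rigid window `c₅ log N_{k+1} / A_k`. [cite: Palasek2026ElementaryModel, §4] -/
theorem palasekTowerBreakdown_heredityFromTwo_speed_jump (h : PalasekTowerBreakdown.HeredityFromTwo) {k : ℕ}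
    (hk : 2 ≤ k) :
    ∀ S : Schedule TowerRates.wide, S.Pins 8 (6 / 5) → S.Rigid → S.Quiet →
      ∀ s : Stage 1 TowerRates.wide S (Margins.routeG TowerRates.wide) k,
      ∀ (u : ℝ → EuclideanSpace ℝ (Fin 3) → EuclideanSpace ℝ (Fin 3))
        (p : ℝ → EuclideanSpace ℝ (Fin 3) → ℝ),
        IsClassicalNSSolutionOn (Icc 0 (S.τ (k + 1))) 1 S.f u p →
        (∀ t ∈ Icc 0 (S.τ k), u t = s.u t ∧ p t = s.p t) →
        (∃ C : ℝ≥0∞, C < ⊤ ∧ ∀ t ∈ Icc 0 (S.τ (k + 1)), ∫⁻ x, ‖u t x‖ₑ ^ 2 ≤ C) →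
        (∀ t ∈ Icc 0 (S.τ (k + 1)), ∀ x, ‖u t x‖ ≤ S.c₂ * TowerRates.wide.Y (k + 1)) →
        ∃ x, ‖x‖ ≤ S.radius ∧
          ∀ y, 6 / 5 * ‖s.u (S.τ k) y‖ ≤ ‖u (S.τ (k + 1)) x‖ ∧ ‖s.u (S.τ k) y‖ < ‖u (S.τ (k + 1)) x‖ :=
  palasekTowerBreakdown_speedFloorAt_exists_exceeds_stage (palasekTowerBreakdown_heredityFromTwo_speedFloorAt h hk)

/-! ## §3 Per-conjunct refutation templates at a level `k ≥ 2`, by name -/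

/-- Door: ONE level `k ≥ 2` at which the speed floor fails refutes the item. [folklore] -/
theorem palasekTowerBreakdown_not_heredityFromTwo_of_not_speedFloorAt {k : ℕ} (hk : 2 ≤ k)
    (h : ¬ SpeedFloorAt k) : ¬ PalasekTowerBreakdown.HeredityFromTwo :=
  fun hH => h (palasekTowerBreakdown_heredityFromTwo_speedFloorAt hH hk)

/-- Door: ONE level `k ≥ 2` at which the strain floor fails refutes the item. [folklore] -/
theorem palasekTowerBreakdown_not_heredityFromTwo_of_not_strainFloorAt {k : ℕ} (hk : 2 ≤ k)
    (h : ¬ StrainFloorAt k) : ¬ PalasekTowerBreakdown.HeredityFromTwo :=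
  fun hH => h (palasekTowerBreakdown_heredityFromTwo_strainFloorAt hH hk)

/-- Door: ONE level `k ≥ 2` at which the core floor fails refutes the item. [folklore] -/
theorem palasekTowerBreakdown_not_heredityFromTwo_of_not_coreFloorAt {k : ℕ} (hk : 2 ≤ k)
    (h : ¬ CoreFloorAt k) : ¬ PalasekTowerBreakdown.HeredityFromTwo :=
  fun hH => h (palasekTowerBreakdown_heredityFromTwo_coreFloorAt hH hk)

/-- Door: ONE level `k ≥ 2` at which the a-priori ceiling fails refutes the item. [folklore] -/
theorem palasekTowerBreakdown_not_heredityFromTwo_of_not_aprioriCeilingAt {k : ℕ} (hk : 2 ≤ k)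
    (h : ¬ AprioriCeilingAt k) : ¬ PalasekTowerBreakdown.HeredityFromTwo := by
  intro hH
  unfold PalasekTowerBreakdown.HeredityFromTwo at hH
  exact h (((heredityFrom_iff_forall_apriori_and_floors (by norm_num : 1 ≤ 2)).1 hH) k hk).1

section Templates

variable {k : ℕ} {S : Schedule TowerRates.wide}

/-- **TEMPLATE, strain conjunct, level `k ≥ 2`** (re-balled form): ONE pinned rigid quiet wide design, ONE
registered level-`k` stage `s`, ONE radius `r` such that `B̄(0, r)` confines `(u₀, f)` and reads the levels
`j ≤ k` of `s`, ONE tame continuation `(u, p)` of `s` to `τ_{k+1}` whose velocity gradient at `τ_{k+1}` has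
operator norm `< c₁ A_{k+1}` throughout `B̄(0, r)` — refutes `PalasekTowerBreakdown.HeredityFromTwo`. (Vacuity
warning: no registered stage at a level `≥ 1` is known.) [cite: Palasek2026ElementaryModel, §4] -/
theorem palasekTowerBreakdown_not_heredityFromTwo_of_continuation_strain_lt (hk : 2 ≤ k)
    (hP : S.Pins 8 (6 / 5)) (hR : S.Rigid) (hQ : S.Quiet)
    (s : Stage 1 TowerRates.wide S (Margins.routeG TowerRates.wide) k) {r : ℝ}
    (hc : S.ConfinedTo r) (hs : ∀ j, j ≤ k → S.ReadsIn j r (s.u (S.τ j)))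
    {u : ℝ → EuclideanSpace ℝ (Fin 3) → EuclideanSpace ℝ (Fin 3)} {p : ℝ → EuclideanSpace ℝ (Fin 3) → ℝ}
    (hcl : IsClassicalNSSolutionOn (Icc 0 (S.τ (k + 1))) 1 S.f u p)
    (hagree : ∀ t ∈ Icc 0 (S.τ k), u t = s.u t ∧ p t = s.p t)
    (henergy : ∃ C : ℝ≥0∞, C < ⊤ ∧ ∀ t ∈ Icc 0 (S.τ (k + 1)), ∫⁻ x, ‖u t x‖ₑ ^ 2 ≤ C)
    (hceil : ∀ t ∈ Icc 0 (S.τ (k + 1)), ∀ x, ‖u t x‖ ≤ S.c₂ * TowerRates.wide.Y (k + 1))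
    (hesc : ∀ x, ‖x‖ ≤ r → ‖fderiv ℝ (u (S.τ (k + 1))) x‖ < S.c₁ * TowerRates.wide.A (k + 1)) :
    ¬ PalasekTowerBreakdown.HeredityFromTwo :=
  palasekTowerBreakdown_not_heredityFromTwo_of_not_strainFloorAt hk
    (not_strainFloorAt_of_continuation_strain_lt hP hR hQ s hc hs hcl hagree henergy hceil hesc)

/-- **TEMPLATE, core conjunct, level `k ≥ 2`** (re-balled form): ONE registered level-`k` stage, ONE admissible
radius `r`, ONE tame continuation carrying at `τ_{k+1}` NO `N_{k+1}`-core loop (closed `C¹` loop of speed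
`≤ 8π/N_{k+1}` inside a ball of radius `1/N_{k+1}`, circulation `≥ c₁ N_{k+1}^{β-2}`) centred in `B̄(0, r)` —
refutes `PalasekTowerBreakdown.HeredityFromTwo`. [cite: Palasek2026ElementaryModel, §3.1] -/
theorem palasekTowerBreakdown_not_heredityFromTwo_of_no_core_in (hk : 2 ≤ k)
    (hP : S.Pins 8 (6 / 5)) (hR : S.Rigid) (hQ : S.Quiet)
    (s : Stage 1 TowerRates.wide S (Margins.routeG TowerRates.wide) k) {r : ℝ}
    (hc : S.ConfinedTo r) (hs : ∀ j, j ≤ k → S.ReadsIn j r (s.u (S.τ j)))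
    {u : ℝ → EuclideanSpace ℝ (Fin 3) → EuclideanSpace ℝ (Fin 3)} {p : ℝ → EuclideanSpace ℝ (Fin 3) → ℝ}
    (hcl : IsClassicalNSSolutionOn (Icc 0 (S.τ (k + 1))) 1 S.f u p)
    (hagree : ∀ t ∈ Icc 0 (S.τ k), u t = s.u t ∧ p t = s.p t)
    (henergy : ∃ C : ℝ≥0∞, C < ⊤ ∧ ∀ t ∈ Icc 0 (S.τ (k + 1)), ∫⁻ x, ‖u t x‖ₑ ^ 2 ≤ C)
    (hceil : ∀ t ∈ Icc 0 (S.τ (k + 1)), ∀ x, ‖u t x‖ ≤ S.c₂ * TowerRates.wide.Y (k + 1))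
    (hno : ∀ (x : EuclideanSpace ℝ (Fin 3)) (γ : ℝ → EuclideanSpace ℝ (Fin 3)), ‖x‖ ≤ r →
      ContDiff ℝ 1 γ → γ 0 = γ 1 →
      (∀ σ ∈ Icc (0 : ℝ) 1, γ σ ∈ Metric.closedBall x (1 / TowerRates.wide.N (k + 1))) →
      (∀ σ ∈ Icc (0 : ℝ) 1, ‖deriv γ σ‖ ≤ 8 * Real.pi / TowerRates.wide.N (k + 1)) →
      circulation (u (S.τ (k + 1))) γ < S.c₁ * TowerRates.wide.N (k + 1) ^ (TowerRates.wide.β - 2)) :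
    ¬ PalasekTowerBreakdown.HeredityFromTwo :=
  palasekTowerBreakdown_not_heredityFromTwo_of_not_coreFloorAt hk
    (not_coreFloorAt_of_no_core_in hP hR hQ s hc hs hcl hagree henergy hceil hno)

/-- **TEMPLATE, speed conjunct as «no jump», level `k ≥ 2`**: ONE registered level-`k` stage `s` and ONE tame
continuation `(u, p)` of it to `τ_{k+1}` whose speed at `τ_{k+1}` on the design ball nowhere reaches `6/5` of
the stage's OWN speed maximum witness `‖s.u(τ_k, y₀)‖` for some `y₀` — i.e. the flow fails to grow by `20 %`
across the window — refutes `PalasekTowerBreakdown.HeredityFromTwo`. [cite: Palasek2026ElementaryModel, §4] -/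
theorem palasekTowerBreakdown_not_heredityFromTwo_of_no_speed_jump (hk : 2 ≤ k)
    (hP : S.Pins 8 (6 / 5)) (hR : S.Rigid) (hQ : S.Quiet)
    (s : Stage 1 TowerRates.wide S (Margins.routeG TowerRates.wide) k)
    {u : ℝ → EuclideanSpace ℝ (Fin 3) → EuclideanSpace ℝ (Fin 3)} {p : ℝ → EuclideanSpace ℝ (Fin 3) → ℝ}
    (hcl : IsClassicalNSSolutionOn (Icc 0 (S.τ (k + 1))) 1 S.f u p)
    (hagree : ∀ t ∈ Icc 0 (S.τ k), u t = s.u t ∧ p t = s.p t)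
    (henergy : ∃ C : ℝ≥0∞, C < ⊤ ∧ ∀ t ∈ Icc 0 (S.τ (k + 1)), ∫⁻ x, ‖u t x‖ₑ ^ 2 ≤ C)
    (hceil : ∀ t ∈ Icc 0 (S.τ (k + 1)), ∀ x, ‖u t x‖ ≤ S.c₂ * TowerRates.wide.Y (k + 1))
    (y₀ : EuclideanSpace ℝ (Fin 3))
    (hslow : ∀ x, ‖x‖ ≤ S.radius → ‖u (S.τ (k + 1)) x‖ < 6 / 5 * ‖s.u (S.τ k) y₀‖) :
    ¬ PalasekTowerBreakdown.HeredityFromTwo := by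
  intro hH
  obtain ⟨x, hx, hall⟩ :=
    palasekTowerBreakdown_heredityFromTwo_speed_jump hH hk S hP hR hQ s u p hcl hagree henergy hceil
  exact absurd (hslow x hx) (not_lt.2 (hall y₀).1)

end Templates

/-! ## §4 The vacuous branch, per conjunct -/

/-- **Emptiness of the level-`2` register proves all four conjuncts at every generic level** (vacuously; every
level-`k` stage with `k ≥ 2` restricts to a level-`2` one): `¬ RungG 2 →
AprioriCeiling ∧ (∀ k ≥ 2, SpeedFloorAt k) ∧ (∀ k ≥ 2, StrainFloorAt k) ∧ (∀ k ≥ 2, CoreFloorAt k)`. The one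
positive route to the item that is not an NS amplification MECHANISM is an amplification CAP; none is asserted.
[cite: Palasek2026ElementaryModel, §4] -/
theorem palasekTowerBreakdown_floors3_of_not_rungG_two (hN : ¬ RungG 2) :
    AprioriCeiling ∧ (∀ k : ℕ, 2 ≤ k → SpeedFloorAt k) ∧ (∀ k : ℕ, 2 ≤ k → StrainFloorAt k) ∧
      (∀ k : ℕ, 2 ≤ k → CoreFloorAt k) := by
  refine palasekTowerBreakdown_heredityFromTwo_iff_apriori_speed_strain_core.1 ?_
  intro S hP hR hQ k hk s
  exact (hN ((show RungG k from ⟨S, hP, hR, hQ, ⟨s⟩⟩).mono hk)).elim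

/-! ## §5 (appended, v2) The hand-over factor BY VALUE: `k`-uniform in form, divergent in content

The registered pin `θ = 6/5` used in §2 is the level-`0` worst case. On the wide rates the floor-to-ceiling ratio of a
hand-over is exactly `c₁ Y_{k+1} / (c₂ Y_k) = (3/5)·N_k^{(b-1)(β-1)} = (3/5)·N_k^{13/100}`: `1.23 / 1.33 / 1.44 /
1.57 / 1.72` at `k = 0 / 1 / 2 / 3 / 4`, and `→ ∞`. So the speed stub of item 19250, although ONE `k`-uniform
sentence, asks of every admissible design an amplification of its spatial speed maximum by a factor that DIVERGES
along the tower, inside windows `c₅ log N_{k+1} / A_k → 0` (in the flow's own Kato units `(c₂ Y_k)² · window =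
(25/9)·c₅·N_k^{3/10}·log N_{k+1}`: `905 / 1176 / 1553 / 2089 / 2868` at `k = 0 … 4`, also divergent; per unit
strain time `A_k⁻¹` the demanded e-folding rate tends to `(b-1)(β-1)/(c₅ b) = 13/1113 ≈ 1.2 %` of `A_k`). This is
the route's «constants drift with `k`» (why-might-fail of 19250) made quantitative on the one conjunct where it is
register arithmetic. -/

/-- **The hand-over factor by value**: on a rigid schedule on the wide-base rates,
`c₁ Y_{k+1} = (3/5)·N_k^{13/100}·(c₂ Y_k)` at every level (`Y_{k+1} = N_k^{(b-1)(β-1)} Y_k`, `c₁ = 1`, `c₂ = 5/3`).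
[folklore] -/
theorem palasekTowerBreakdown_handover_factor_eq {S : Schedule TowerRates.wide} (hR : S.Rigid) (k : ℕ) :
    S.c₁ * TowerRates.wide.Y (k + 1) =
      3 / 5 * TowerRates.wide.N k ^ ((13 : ℝ) / 100) * (S.c₂ * TowerRates.wide.Y k) := by
  have hexp : (TowerRates.wide.b - 1) * (TowerRates.wide.β - 1) = (13 : ℝ) / 100 := by
    simp only [TowerRates.wide]; norm_num
  rw [TowerRates.wide.Y_succ k, hexp, hR.c₁_eq, hR.c₂_eq]
  ring

/-- **The hand-over factor diverges along the tower**: `(3/5)·N_k^{13/100} → ∞`. [folklore] -/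
theorem palasekTowerBreakdown_handover_factor_tendsto_atTop :
    Filter.Tendsto (fun k : ℕ => 3 / 5 * TowerRates.wide.N k ^ ((13 : ℝ) / 100)) Filter.atTop Filter.atTop := by
  refine Filter.Tendsto.const_mul_atTop (by norm_num : (0 : ℝ) < 3 / 5) ?_
  exact (tendsto_rpow_atTop (by norm_num : (0 : ℝ) < 13 / 100)).comp TowerRates.wide.tendsto_N_atTop

/-- The scales are monotone from level `2` on: `N_2 ≤ N_k` for `k ≥ 2` (`N_k = N₀^{b^k}`, `N₀, b > 1`). [folklore] -/
theorem palasekTowerBreakdown_N_two_le {k : ℕ} (hk : 2 ≤ k) : TowerRates.wide.N 2 ≤ TowerRates.wide.N k := by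
  unfold TowerRates.N
  exact Real.rpow_le_rpow_of_exponent_le TowerRates.wide.one_lt_N₀.le
    (pow_le_pow_right₀ TowerRates.wide.one_lt_b.le hk)

/-- **At the generic levels the factor already exceeds `7/5`** (certified): for `k ≥ 2`,
`7/5 < (3/5)·N_k^{13/100}` (`N_k ≥ N_2 > 820` and `820^{13} > (7/3)^{100}`; true value at `k = 2`: `1.435…`).
[folklore] -/
theorem palasekTowerBreakdown_handover_factor_gt {k : ℕ} (hk : 2 ≤ k) :
    (7 / 5 : ℝ) < 3 / 5 * TowerRates.wide.N k ^ ((13 : ℝ) / 100) := by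
  have hN2 : (820 : ℝ) < TowerRates.wide.N 2 := TowerRates.wide_N_two_bounds.1
  have hNk : (820 : ℝ) < TowerRates.wide.N k := lt_of_lt_of_le hN2 (palasekTowerBreakdown_N_two_le hk)
  have hN0 : (0 : ℝ) ≤ TowerRates.wide.N k := (TowerRates.wide.N_pos k).le
  suffices h : (7 / 3 : ℝ) < TowerRates.wide.N k ^ ((13 : ℝ) / 100) by linarith
  by_contra hle
  rw [not_lt] at hle
  have hp0 : (0 : ℝ) ≤ TowerRates.wide.N k ^ ((13 : ℝ) / 100) := Real.rpow_nonneg hN0 _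
  have h100 : (TowerRates.wide.N k ^ ((13 : ℝ) / 100)) ^ (100 : ℕ) ≤ (7 / 3 : ℝ) ^ (100 : ℕ) :=
    pow_le_pow_left₀ hp0 hle 100
  have hlhs : (TowerRates.wide.N k ^ ((13 : ℝ) / 100)) ^ (100 : ℕ) = TowerRates.wide.N k ^ (13 : ℕ) := by
    rw [← Real.rpow_natCast, ← Real.rpow_mul hN0]
    norm_num
  rw [hlhs] at h100
  have h820 : (820 : ℝ) ^ (13 : ℕ) < TowerRates.wide.N k ^ (13 : ℕ) :=
    pow_lt_pow_left₀ hNk (by norm_num) (by norm_num)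
  have hnum : (7 / 3 : ℝ) ^ (100 : ℕ) < (820 : ℝ) ^ (13 : ℕ) := by norm_num
  linarith

/-- **The speed jump BY VALUE, by name.** Under `PalasekTowerBreakdown.HeredityFromTwo`: for every `k ≥ 2`, every
admissible design, every registered level-`k` stage `s` and every tame continuation `(u, p)` of `s` to `τ_{k+1}`,
some point `x` of the ball has `‖u(τ_{k+1}, x)‖ ≥ (3/5)·N_k^{13/100}·‖s.u(τ_k, y)‖` for ALL `y ∈ ℝ³` — a factor
`> 7/5` at every generic level and UNBOUNDED along the tower (`palasekTowerBreakdown_handover_factor_gt`,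
`…_tendsto_atTop`). [cite: Palasek2026ElementaryModel, §4] -/
theorem palasekTowerBreakdown_heredityFromTwo_speed_jump_by_value (h : PalasekTowerBreakdown.HeredityFromTwo)
    {k : ℕ} (hk : 2 ≤ k) :
    ∀ S : Schedule TowerRates.wide, S.Pins 8 (6 / 5) → S.Rigid → S.Quiet →
      ∀ s : Stage 1 TowerRates.wide S (Margins.routeG TowerRates.wide) k,
      ∀ (u : ℝ → EuclideanSpace ℝ (Fin 3) → EuclideanSpace ℝ (Fin 3))
        (p : ℝ → EuclideanSpace ℝ (Fin 3) → ℝ),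
        IsClassicalNSSolutionOn (Icc 0 (S.τ (k + 1))) 1 S.f u p →
        (∀ t ∈ Icc 0 (S.τ k), u t = s.u t ∧ p t = s.p t) →
        (∃ C : ℝ≥0∞, C < ⊤ ∧ ∀ t ∈ Icc 0 (S.τ (k + 1)), ∫⁻ x, ‖u t x‖ₑ ^ 2 ≤ C) →
        (∀ t ∈ Icc 0 (S.τ (k + 1)), ∀ x, ‖u t x‖ ≤ S.c₂ * TowerRates.wide.Y (k + 1)) →
        ∃ x, ‖x‖ ≤ S.radius ∧
          ∀ y, 3 / 5 * TowerRates.wide.N k ^ ((13 : ℝ) / 100) * ‖s.u (S.τ k) y‖ ≤ ‖u (S.τ (k + 1)) x‖ := by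
  intro S hP hR hQ s u p hcl hagree hE hceil
  obtain ⟨x, hx, hfl⟩ :=
    palasekTowerBreakdown_heredityFromTwo_speedFloorAt h hk S hP hR hQ s u p hcl hagree hE hceil
  refine ⟨x, hx, fun y => le_trans ?_ hfl⟩
  rw [palasekTowerBreakdown_handover_factor_eq hR k]
  have hF : (0 : ℝ) ≤ 3 / 5 * TowerRates.wide.N k ^ ((13 : ℝ) / 100) :=
    mul_nonneg (by norm_num) (Real.rpow_nonneg (TowerRates.wide.N_pos k).le _)
  exact mul_le_mul_of_nonneg_left (s.ceiling k le_rfl (S.τ k) ⟨(S.τ_pos k).le, le_rfl⟩ y) hF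

end Summit.NavierStokesRegularity.NavierStokesRegularity.Theorems
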